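import Mathlib
import Summits.Ventures.PercRepro2.Defs

/-!
# The cleared `(K′)`-form as a polynomial, and its expansion along an affine line of masses
(blind cell PercRepro2, mine-c g37; `conjectures/MINE-C.md` §46.3)

`kprimeFormPoly` is the cleared `(K′)`-form `(A·D₀ − N₀·H)·YS + Sm·((O1e·D₀ − N₀·O1) − (C·D₀ − N₀·D))`
as a cubic polynomial in the ten masses; `kprimeFormLin` / `kprimeFormQuad` are its linear and
quadratic polarisations, so that `kprimeFormPoly (M + β·dM) = kprimeFormPoly M + β·Lin + β²·Quad +
β³·kprimeFormPoly dM` (`kprimeFormPoly_affine`).  At a PENDANT point (every `X`-mass `q` times its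
base mass) the form vanishes (`kprimeFormPoly_pendant`), and along the increment of the LEAK
expansion of `MINE-C.md` §46.3 the linear coefficient is `(1 − q)·(form(b := z) + q·Glue)`
(`kprimeFormLin_pendant`) — the algebra of `KPrimeLeakLinear.lean`, kept separate.
-/

namespace Summit.Ventures.PercRepro2

namespace KPrime

variable {R : Type*} [Field R] [LinearOrder R] [IsStrictOrderedRing R]

/-! ### The cleared form as a polynomial, and its expansion along an affine line of masses -/

section Algebra

variable (R)

/-- The cleared `(K′)`-form as a polynomial in the ten masses
`(A, H, YS, Sm, O1e, O1, C, D, N₀, D₀)`. -/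
def kprimeFormPoly (A H YS Sm O1e O1 C D N₀ D₀ : R) : R :=
  (A * D₀ - N₀ * H) * YS + Sm * ((O1e * D₀ - N₀ * O1) - (C * D₀ - N₀ * D))

/-- The LINEAR polarisation of `kprimeFormPoly`: the coefficient of `β` in
`kprimeFormPoly (M + β·dM)` (every monomial with exactly one `d`-factor). -/
def kprimeFormLin (A H YS Sm O1e O1 C D N₀ D₀ dA dH dYS dSm dO1e dO1 dC dD dN₀ dD₀ : R) : R :=
  (dA * D₀ * YS + A * dD₀ * YS + A * D₀ * dYS) - (dN₀ * H * YS + N₀ * dH * YS + N₀ * H * dYS) +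
    (dSm * O1e * D₀ + Sm * dO1e * D₀ + Sm * O1e * dD₀) -
    (dSm * N₀ * O1 + Sm * dN₀ * O1 + Sm * N₀ * dO1) -
    (dSm * C * D₀ + Sm * dC * D₀ + Sm * C * dD₀) + (dSm * N₀ * D + Sm * dN₀ * D + Sm * N₀ * dD)

/-- The QUADRATIC polarisation of `kprimeFormPoly`: the coefficient of `β²` in
`kprimeFormPoly (M + β·dM)` (every monomial with exactly two `d`-factors). -/
def kprimeFormQuad (A H YS Sm O1e O1 C D N₀ D₀ dA dH dYS dSm dO1e dO1 dC dD dN₀ dD₀ : R) : R :=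
  (A * dD₀ * dYS + dA * D₀ * dYS + dA * dD₀ * YS) - (N₀ * dH * dYS + dN₀ * H * dYS + dN₀ * dH * YS) +
    (Sm * dO1e * dD₀ + dSm * O1e * dD₀ + dSm * dO1e * D₀) -
    (Sm * dN₀ * dO1 + dSm * N₀ * dO1 + dSm * dN₀ * O1) -
    (Sm * dC * dD₀ + dSm * C * dD₀ + dSm * dC * D₀) + (Sm * dN₀ * dD + dSm * N₀ * dD + dSm * dN₀ * D)

variable {R}

omit [LinearOrder R] [IsStrictOrderedRing R] in
/-- **The expansion along an affine line of masses**: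
`kprimeFormPoly (M + β·dM) = kprimeFormPoly M + β·Lin + β²·Quad + β³·kprimeFormPoly dM`. -/
lemma kprimeFormPoly_affine (A H YS Sm O1e O1 C D N₀ D₀ dA dH dYS dSm dO1e dO1 dC dD dN₀ dD₀ β : R) :
    kprimeFormPoly R (A + β * dA) (H + β * dH) (YS + β * dYS) (Sm + β * dSm) (O1e + β * dO1e)
        (O1 + β * dO1) (C + β * dC) (D + β * dD) (N₀ + β * dN₀) (D₀ + β * dD₀) =
      kprimeFormPoly R A H YS Sm O1e O1 C D N₀ D₀ +
        β * kprimeFormLin R A H YS Sm O1e O1 C D N₀ D₀ dA dH dYS dSm dO1e dO1 dC dD dN₀ dD₀ +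
        β ^ 2 * kprimeFormQuad R A H YS Sm O1e O1 C D N₀ D₀ dA dH dYS dSm dO1e dO1 dC dD dN₀ dD₀ +
        β ^ 3 * kprimeFormPoly R dA dH dYS dSm dO1e dO1 dC dD dN₀ dD₀ := by
  unfold kprimeFormPoly kprimeFormLin kprimeFormQuad
  ring

omit [LinearOrder R] [IsStrictOrderedRing R] in
/-- At the pendant point (every `X`-mass `q` times its base mass) the form vanishes. -/
lemma kprimeFormPoly_pendant (H YS Sm O1 D D₀ q : R) :
    kprimeFormPoly R (q * H) H YS Sm (q * O1) O1 (q * D) D (q * D₀) D₀ = 0 := by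
  unfold kprimeFormPoly; ring

omit [LinearOrder R] [IsStrictOrderedRing R] in
/-- **The first-order coefficient at the pendant point is `(1 − q)·(form(b := z) + q·Glue)`**:
with the base masses `(H, YS, Sm, O1, D, D₀)`, the `z`-masses `(Az, O1ez, Cz, N₀z)` and the glued
masses `(Hg, YSg, Smg, O1g, Dg, D₀g)`, the increment of the mass vector along the leak is
`dM = q·Mg + (1 − q)·Mz − M₀`, and `Lin(M₀, dM) = (1 − q)·(formZ + q·Glue)`. -/
lemma kprimeFormLin_pendant (H YS Sm O1 D D₀ Az O1ez Cz N₀z Hg YSg Smg O1g Dg D₀g q : R) :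
    kprimeFormLin R (q * H) H YS Sm (q * O1) O1 (q * D) D (q * D₀) D₀
        (q * Hg + (1 - q) * Az - q * H) (q * Hg + (1 - q) * H - H) (q * YSg + (1 - q) * YS - YS)
        (q * Smg + (1 - q) * Sm - Sm) (q * O1g + (1 - q) * O1ez - q * O1)
        (q * O1g + (1 - q) * O1 - O1) (q * Dg + (1 - q) * Cz - q * D) (q * Dg + (1 - q) * D - D)
        (q * D₀g + (1 - q) * N₀z - q * D₀) (q * D₀g + (1 - q) * D₀ - D₀) =
      (1 - q) * (kprimeFormPoly R Az H YS Sm O1ez O1 Cz D N₀z D₀ +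
        q * (D₀ * (YS * Hg + Sm * (O1g - Dg)) - D₀g * (YS * H + Sm * (O1 - D)))) := by
  unfold kprimeFormLin kprimeFormPoly; ring

end Algebra


end KPrime

end Summit.Ventures.PercRepro2
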